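import Summits.BirchSwinnertonDyer.BirchSwinnertonDyer.Theses.AdditiveKolyvaginRoad
import Summits.BirchSwinnertonDyer.BirchSwinnertonDyer.Theorems.AdditiveKolyvaginRoadManinFrameResidueProperRUnitTwist
import HarnessLib

/-!
# Route `AdditiveKolyvaginRoad`, crux `ManinFrameResidueProperR` (stmt-BirchSwinnertonDyer-20709):
# the EULER-SYSTEM composition — the crux BY NAME from the `p ∈ {5, 7}` stub S57, the Kato–Kosters–
# Pannekoek Néron-integrality fact and a UNIT-TWIST SUPPLY on the `p ≥ 11` residue (helper, `--supports`)

Cell `pub/bsd-wall` (D-0120, W-ALL row 2), seat `bsd-wall-manin-p1` g2 (prover). THEOREMS ONLY (no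
definition, no named fact, no `sorry`); nothing is booked, no item is closed. Thin file: imports the
route file (decl name only) and the helper `…ManinFrameResidueProperRUnitTwist.lean` (p553877).

WHAT IT IS. The registered skeleton `Cruxes/ManinFrameResidueProperR/Lines/birth.lean` (v1.1) proves
`ManinFrameResidueProperR` from S57 `stub_memberManinUnit_fiveSeven` (`p ∈ {5, 7}`) and TDS
`stub_twistDegreeStep` (`p ≥ 11`; Manin's `p`-part on Edixhoven's exceptional locus, open in print).
p553877 proved TDS at a frame from (i) the Literature fact
`kato_neron_padicValRat_twistedSymbolSum_nonneg_of_additive` (Kato (8.1.3)/9.7/6.6 + Kim–Nakamura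
2.1/2.4 ⟸ Kosters–Pannekoek Thm. 1, read in Néron units; p552770) and (ii) K4 at the frame — ONE
quadratic twist of conductor prime to `pN` whose `N`-imprimitive Birch–Manin value in the units of the
newform is a `p`-unit. `maninFrameResidueProperR_of_fiveSeven_of_kato_of_unitTwistSupply` below is the
composition `ManinFrameResidueProperR_of` of the skeleton with TDS REPLACED by the fact + the residue-wide
unit-twist supply (K4U): i.e. the shape of a second line on the crux, `{S57, stub_unitTwistSupply :=
hK4U}`, which the tenure desk may register ONLY after adding the fact as a by-name binder of the crux
(TYPING-CHECKLIST T10: a composition may consume only crux binders and stubs; cf. kit R / item 20708).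
It skips TDS altogether (member with `p ∤ c` ⟹ transport ⟹ Hoffstein–Luo frame, as in the skeleton),
so the antecedents `EdixhovenManin…` / `Dokchitser…` of the R-crux are not even used on this path.
Sorry-free because S57, the fact and K4U enter as HYPOTHESES (a `--supports` reading, not a closure:
S57 and K4U are open; the fact is XL print).
References: [Kato2004Asterisque] (8.1.3), Thm. 6.6, 9.7; [KimNakamura2020] Thm. 2.1, Cor. 2.4;
[KostersPannekoek2017] Thm. 1; [EdixhovenManin1991] §4; [HoffsteinLuo1997] Theorem (§1);
[MazurTateTeitelbaum1986] §I.8.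
-/

set_option autoImplicit false
set_option linter.dupNamespace false

noncomputable section

open scoped Classical

open WeierstrassCurve NumberField Literature.NumberTheory.EllipticCurves
  Literature.NumberTheory.EllipticCurves.ModularForms
  Literature.NumberTheory.EllipticCurves.Rank1Residual
  Literature.NumberTheory.DiophantineGeometry IsDedekindDomain Rat.HeightOneSpectrum
  Summit.BirchSwinnertonDyer.Rank1Residual Summit.BirchSwinnertonDyer.Rank1Residual.Additive
  Summit.BirchSwinnertonDyer.BirchSwinnertonDyer.Theses.AdditiveKolyvaginRoad CongruenceSubgroup

namespace Summit.BirchSwinnertonDyer.BirchSwinnertonDyer.Theorems.ManinFrameResidueProperRUnitTwistComposition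

/-- **`ManinFrameResidueProperR` from S57, the Kato–Kosters–Pannekoek fact and a unit-twist supply on
the `p ≥ 11` residue.** Hypotheses: `h57` = the registered stub `stub_memberManinUnit_fiveSeven`
VERBATIM (as a hypothesis); `hK` = the Literature fact (p552770); `hK4U` = K4 at every residue frame
(`p ≥ 11`, additive, `E[p]` irreducible, residue clause, degree clause, `r_an = 1`, newform `f`):
some primitive non-trivial quadratic `χ` of conductor `m` prime to `p·N(W)` and some `r ∈ ℚ`, `r ≠ 0`,
`ord_p r ≤ 0`, with `∏_{ℓ ∥ N}(ℓ − a_ℓχ(ℓ)) · Σ_a χ(a){∞,a/m}_f = r·Ω⁺_f` (even `χ`) or `= r·Ω⁻_f·i`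
(odd `χ`). Conclusion: the crux decl, by name. Proof = the skeleton's composition with the `p ≥ 11`
branch supplied by `exists_member_not_dvd_c_of_unitQuadraticTwist` (p553877), then the prime-to-`p`
transport and the Hoffstein–Luo frame (conjuncts 6, 7 of `PublishedInputsAdditiveKoly`).
[cite: Kato2004Asterisque, (8.1.3) (p. 180) and Thm. 9.7 (p. 189)] [cite: KimNakamura2020, Cor. 2.4]
[cite: HoffsteinLuo1997, Theorem (§1)] -/
theorem maninFrameResidueProperR_of_fiveSeven_of_kato_of_unitTwistSupply
    (h57 : ∀ (_ : Literature.NumberTheory.EllipticCurves.ModularForms.exists_isNewformOf)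
      (W : WeierstrassCurve ℚ) [W.IsElliptic] [W.IsGloballyMinimal] (p : ℕ) [Fact p.Prime]
      [NeZero (W.conductorNorm ℤ)], 5 ≤ p → p < 11 → Addv W p → Irr W p →
      ((p < 11 ∨ ∃ (W' : WeierstrassCurve ℚ) (_ : W'.IsElliptic) (_ : W'.IsGloballyMinimal),
          IsIsogenous W W' ∧ TypeGOrd W' p ∧ padicValInt p W'.minimalDiscriminantInt ≤ 4) ∧
        (∃ (W' : WeierstrassCurve ℚ) (_ : W'.IsElliptic) (_ : W'.IsGloballyMinimal),
          IsIsogenous W W' ∧ ∀ (v : HeightOneSpectrum ℤ) (n : ℕ), natGenerator v = p →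
            W'.kodairaSymbolAt v ≠ KodairaSymbol.Istar n)) →
      (∀ (W' : WeierstrassCurve ℚ) [W'.IsElliptic] [W'.IsGloballyMinimal]
          (D' : ModularParametrizationData W' (W.conductorNorm ℤ)),
          IsIsogenous W W' → p ∣ D'.modularDegree) →
      ∃ (W₀ : WeierstrassCurve ℚ) (_ : W₀.IsElliptic) (_ : W₀.IsGloballyMinimal)
        (D₀ : ModularParametrizationData W₀ (W.conductorNorm ℤ)),
        IsIsogenous W W₀ ∧ ¬ (p : ℤ) ∣ D₀.c)
    (hK : kato_neron_padicValRat_twistedSymbolSum_nonneg_of_additive)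
    (hK4U : ∀ (W : WeierstrassCurve ℚ) [W.IsElliptic] [W.IsGloballyMinimal] (p : ℕ) [Fact p.Prime]
      [NeZero (W.conductorNorm ℤ)], 11 ≤ p → Addv W p → Irr W p →
      ((p < 11 ∨ ∃ (W' : WeierstrassCurve ℚ) (_ : W'.IsElliptic) (_ : W'.IsGloballyMinimal),
          IsIsogenous W W' ∧ TypeGOrd W' p ∧ padicValInt p W'.minimalDiscriminantInt ≤ 4) ∧
        (∃ (W' : WeierstrassCurve ℚ) (_ : W'.IsElliptic) (_ : W'.IsGloballyMinimal),
          IsIsogenous W W' ∧ ∀ (v : HeightOneSpectrum ℤ) (n : ℕ), natGenerator v = p →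
            W'.kodairaSymbolAt v ≠ KodairaSymbol.Istar n)) →
      (∀ (W' : WeierstrassCurve ℚ) [W'.IsElliptic] [W'.IsGloballyMinimal]
          (D' : ModularParametrizationData W' (W.conductorNorm ℤ)),
          IsIsogenous W W' → p ∣ D'.modularDegree) →
      W.analyticRank = 1 →
      ∀ (f : CuspForm (Gamma0 (W.conductorNorm ℤ)) 2), IsNewformOf W f →
      ∃ (m : ℕ) (_ : NeZero m) (χ : DirichletCharacter ℂ m) (r : ℚ),
        m.Coprime (p * W.conductorNorm ℤ) ∧ χ.IsPrimitive ∧ χ ≠ 1 ∧ MulChar.IsQuadratic χ ∧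
        r ≠ 0 ∧ padicValRat p r ≤ 0 ∧
        ((χ.Even ∧
          (∏ ℓ ∈ (W.conductorNorm ℤ).primeFactors with ¬ ℓ ^ 2 ∣ W.conductorNorm ℤ,
              ((ℓ : ℂ) - (W.LFunction ℓ : ℂ) * χ (ℓ : ZMod m))) *
            twistedSymbolSum f χ = (r : ℂ) * (plusPeriod f : ℂ)) ∨
        (χ.Odd ∧
          (∏ ℓ ∈ (W.conductorNorm ℤ).primeFactors with ¬ ℓ ^ 2 ∣ W.conductorNorm ℤ,
              ((ℓ : ℂ) - (W.LFunction ℓ : ℂ) * χ (ℓ : ZMod m))) *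
            twistedSymbolSum f χ = (r : ℂ) * (minusPeriod f : ℂ) * Complex.I))) :
    ManinFrameResidueProperR := by
  intro _e1 _e2 _dd hPub W _ _ p hp _ hp5 hadd hirr hres hall hr
  have hnf : exists_isNewformOf := hPub.2.2.2.2.2.1
  -- a member with a Manin-unit datum, by prime range: S57 below 11, fact + K4 from 11 on
  have hmem : ∃ (W₀ : WeierstrassCurve ℚ) (_ : W₀.IsElliptic) (_ : W₀.IsGloballyMinimal)
      (D₀ : ModularParametrizationData W₀ (W.conductorNorm ℤ)),
      IsIsogenous W W₀ ∧ ¬ (p : ℤ) ∣ D₀.c := by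
    rcases lt_or_ge p 11 with h11 | h11
    · exact h57 hnf W p hp5 h11 hadd hirr hres hall
    · obtain ⟨f, hf⟩ := hnf W
      exact ManinFrameResidueProperRUnitTwist.exists_member_not_dvd_c_of_unitQuadraticTwist hK hnf W
        h11 hadd hirr f hf (hK4U W p h11 hadd hirr hres hall hr f hf)
  obtain ⟨W₀, hE₀, hM₀, D₀, hiso, hc₀⟩ := hmem
  haveI := hE₀
  haveI := hM₀
  -- transport to a datum of `W` with `p ∤ c`, then the Hoffstein–Luo odd Heegner frame
  obtain ⟨Dt, hc⟩ :=
    ManinFrameTransport.exists_modularParametrizationData_not_dvd_of_partner W hp.out hirr hiso D₀ hc₀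
  exact ManinFrameFromDatum.exists_oddHeegnerFrame_of_exists_not_dvd hnf hPub.2.2.2.2.2.2.1 W p hr
    (by omega) ⟨Dt, hc⟩

end Summit.BirchSwinnertonDyer.BirchSwinnertonDyer.Theorems.ManinFrameResidueProperRUnitTwistComposition

end
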